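import Summits.QuantumFields.BalabanUV.T4Continuum.Support.B13Carriers

/-!
# SUBSTRATE — the TWO RUNS DRIVEN BY THE SAME UNIT-LATTICE FIELD `V` on the carriers of record
# (run A: spacing `ε = L^{−K}`, `K` steps, background `U^A_K(V)` on `T_ε`; run B: spacing `ε/L`, `K + 1` steps, background
# `U^B_{K+1}(V)` on `T_{ε/L}`; the SAME `V` on the unit lattice `T_1`), and node U3's comparison sentence AT THE SAME `V` by name

Cell `pub-balaban`, SUBSTRATE cell (coordinator + user 2026-08-20), seat `b2b-balaban-substrate-p1` («instances first»): the shared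
instantiation layer «that no row owns» (`t4/b2b-balaban-t4-ne4-p1/SKELETON-NE4.md` §4 (b); `t4/b2b-balaban-t4-ne9-p1/SKELETON-NE9-P1.md`
O-NE9-1; `BINDER-OWNERS.md` row NE7 «NODE O … constructed by nobody — blocker (α) common to all rows»).  Summits-side, under the
LEAN PLACEMENT RULE (cell modelling + bookkeeping; NOT a Literature module).  EXTENDS — never forks — the carriers of record
`B13Carriers.TwoRuns` ∕ `TwoRuns.carriers` (NE5 claim-table row O1-a, p207668).

HONEST FRAMING (T4-DAG v1 PAGE 1).  Rung (B)+1 of the FINITE-VOLUME T⁴ programme — existence AND uniqueness of the `ε → 0` limit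
of Bałaban's unit-scale averaged expectations on a FIXED torus — NOT infinite volume, NOT a mass gap, NOT the Clay problem.  This
file is TYPING + DEFINITIONAL BOOKKEEPING: no estimate, no `def … : Prop` fact about Bałaban's objects, nothing printed in the
audited series is asserted (the background assignments `V ↦ U_k(V)` are `Setup.Background` DATA whose defining property —
minimality on the constraint surface, [Balaban1987RG1] (0.21) p. 256, [Balaban1985Variational] Thm 1 p. 279 — is carried ON A
DOMAIN chosen by the instancer; B11 Thm 1 is a quoted leaf, asserted for nothing here).  Spine PROVED 0∕9 unchanged.
HONEST DEPENDENCY (cell line, verbatim): continuum YM on T⁴ ⇐ BetaPertH ∧ nine spine estimates (0/9 proved); BetaPertH ⇐ (D1) ∧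
(D4) ∧ CAP+tail; G-an2-4 gates asym, D1 and NE2/3/4.

WHAT THE CARRIERS OF RECORD DO NOT CARRY, AND THIS FILE ADDS.  `TwoRuns G` fixes the torus family `F`, run A's step number `K`
(run B has `K + 1`), the big-cube exponent `m'`, ONE block averaging `av` on run B's finest lattice (the transport's), and the two
admissible classes `admA ∕ admB`; node U3's hypothesis shapes (`T4OutputRate.NE5 ∕ NE9 ∕ LipBackground`) quantify over ALL
admissible backgrounds.  What node U3 ∕ U5 actually COMPARE (T4-DAG §2 U3, verbatim: «`E^{(j),A}(X; g^A, U^A_K(V))` versus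
`E^{(j+1),B}(X; g^B, U^B_{K+1}(V))` … driven by the SAME unit-lattice field V») needs, in addition:
* §1 the unit-lattice field `V : UnitField F G := GaugeField (F.P 0) 0 G` (the cell's universal unit lattice `T_1`, `2·L^m` sites
  per direction for EVERY run, `T4LevelShift.sitesPerDir_unit`) read on run `K`'s top level `K` (`atTop F K V`, the inverse of
  `T4LevelShift.unitShift K`), and the LADDER identification of run B's level `j + 1` with run A's level `j`
  (`T4LevelShift.ladderShift`; `atTop_ladder : ladderShift (atTop F (K+1) V) = atTop F K V`);
* §2 the structure **`DrivenRuns G extends TwoRuns G`**: both runs' complete block-averaging families `avA : ∀ j, Averaging (F.P K) j G`,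
  `avB : ∀ j, Averaging (F.P (K+1)) j G` with `avB 0 = av` (run B's first averaging IS the transport's) and the displayed
  LEVEL-HOMOGENEITY `avA j ∘ ladderShift = ladderShift ∘ avB (j+1)` (the two runs average by the same prescription at the same
  physical scale — a THEOREM for Bałaban's (0.4) averaging, `T4LevelShift.blockAvg_fieldShift`, see `DrivenRuns.balaban` §5);
  Bałaban's background assignments `bgA : Background (F.P K) G avA`, `bgB : Background (F.P (K+1)) G avB` ([Balaban1987RG1]
  (0.21) p. 256 «U_k(V) … the minimum of the action … on the set of all U such that Ū^k = V» — `Setup.IsBackground` on the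
  instancer's domains); the common domain `domV` of driving fields with its four membership requirements DISPLAYED (top domains of
  both assignments; admissibility of the two backgrounds into `admA ∕ admB`); the two runs' coupling sequences `gA`, `gB` (run B
  has `K + 1` couplings; node U3 reads run B's RE-INDEXED sequence `gBre j = gB (j + 1)`, `T4OutputRate` §1, cell GAPS G-t4-U3-5);
* §3 the SAME-V BACKGROUND MAPS `uA : domV → carriers.BgA` (`V ↦ U^A_K(V)`) and `uB : domV → carriers.BgB` (`V ↦ U^B_{K+1}(V)`)
  with their defining properties BY NAME from `IsBackground` (constraint `M^K(U^A_K V) = V`, regularity, minimality);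
* §4 THE TRANSPORT MAPS RUN B's CONSTRAINT SURFACE OVER `V` INTO RUN A's (`iter_transportRaw`: `M_A^k(transport U) =
  ladderShift (M_B^{k+1} U)` for all `k`, from the level-homogeneity; hence `constraint_transport`), so `transport (U^B_{K+1}(V))`
  is a COMPETITOR in run A's variational problem over the same `V` and — under the displayed class requirement `regMaps` —
  **`wilsonAction4 (U^A_K V) ≤ wilsonAction4 (transport (U^B_{K+1} V))`** (`action_uA_le_transport_uB`: the first line of node
  U1b's minimal-action comparison, [Balaban1987RG1] (2.3) p. 265 «V^{(k)} = Ū^k_{k+1} = M^k(U_{k+1})» being the printed instance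
  of «averages of finer minimisers are competitors»; NO rate is claimed — NE3 is row t4-ne3's);
* §5 node U3 ON THE OBJECT: NE3's consumer shape `T4OutputRate.BackgroundsClose uA uB δ` unfolded (`backgroundsClose_iff`), and
  **`u3_threeBrackets_driven`** = `T4OutputRate.u3_threeBrackets` AT `UA := uA V`, `UB := uB V` — the T4-DAG sentence
  «|E^{(j),A}(X; g^A, U^A_K(V)) − E^{(j+1),B}(X; g^B_re, U^B_{K+1}(V))| ≤ (C_U·δ + Σ_{i<j} Λ j i |g^A_i − g^B_{i+1}| + C₅θ^j)·e^{−κd_j(X)}»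
  with every located input visible; `u3_geometric_driven` likewise;
* §6 NON-VACUITY: `DrivenRuns.balaban F K m' ℰ bgA bgB` — BOTH runs averaged at EVERY level by Bałaban's (0.4) block averaging
  `BlockAveraging.blockAvg ℰ` (the level-homogeneity field DISCHARGED by `blockAvg_fieldShift`), unrestricted admissible classes,
  arbitrary supplied background assignments, `domV` := the fields whose top copies lie in both assignments' domains; and the
  trivially-driven instance (`Background` with empty domains) showing the structure is inhabited for every `F, K, m', ℰ`.

WHAT IS *NOT* CLAIMED.  No existence of minimisers (B11 Thm 1 TYPE stays the instancer's `Background` datum ∕ row NE3's leaves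
A-H1∕A-H3); no closeness of `U^A_K(V)` and `transport (U^B_{K+1}(V))` (that IS NE3, node U1b — here only its consumer SHAPE is
placed on the object); no statement about the couplings beyond their typing (node U2 ∕ NE4 and the β sub-cell own `gA`, `gB`);
junk levels `j > m + K` of `Setup` are not excluded by the types (statements needing the standing range carry it, as in
`B13Carriers`).  Value = the two-run object every U3∕U5 consumer quantifies over, typed ONCE; NOT summit progress.

CITATION HEADER.  T. Bałaban, *Renormalization group approach to lattice gauge field theories. I*, Commun. Math. Phys. **109**
(1987) 249–301 [Balaban1987RG1] — (0.1) p. 251 (the tori), (0.4)∕(0.11) p. 253 (averagings), (0.21)–(0.22) p. 256 (backgrounds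
`U_k(V)`), (2.3) p. 265; T. Bałaban, *The variational problem and background fields in renormalization group method for lattice
gauge theories*, Commun. Math. Phys. **102** (1985) 277–309 [Balaban1985Variational] Thm 1 p. 279 (existence of minimisers — QUOTED
LEAF, the TYPE of `Setup.IsBackground`).  The manuscripts are UNDER ADJUDICATION by the cell: cited for KIND ∕ locus only; no
sentence of theirs is a hypothesis or a conclusion below.  Imports BY NAME: `Support/B13Carriers` (hence `T4OutputRate`,
`T4LevelShift`, `BlockAveraging`, `Setup`, `T4Continuum`); nothing existing is modified.
-/

noncomputable section

open scoped BigOperators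

namespace Summit.QuantumFields.BalabanUV.T4Continuum.SubstrateTwoRunsDriven

open Literature.MathematicalPhysics.QuantumFieldTheory.Balaban1983to89
open Literature.MathematicalPhysics.QuantumFieldTheory.Balaban1983to89.T4OutputRate
open Literature.MathematicalPhysics.QuantumFieldTheory.Balaban1983to89.T4Continuum (T4Family)
open Literature.MathematicalPhysics.QuantumFieldTheory.Balaban1983to89.T4LevelShift
open Summit.QuantumFields.BalabanUV.T4Continuum.B13Carriers

/-! ## §1 The unit-lattice field of all runs, read on a run's top level; the ladder -/

section Unit

variable (F : T4Family) (G : Type)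

/-- [folklore] THE UNIT-LATTICE FIELDS common to all runs: configurations on `T_1` = level `0` of the `0`-th torus of the family
(`2·L^m` sites per direction; `T4Continuum.USite`), the labels on which the cell's unit-scale observables live. -/
abbrev UnitField : Type := GaugeField (F.P 0) 0 G

variable {F G}

/-- [folklore] The unit field read on run `K`'s top level `K` (the inverse of `T4LevelShift.unitShift K`; both lattices have
`2·L^m` sites per direction, `sitesPerDir_unit`). -/
def atTop (K : ℕ) (V : UnitField F G) : GaugeField (F.P K) K G := fieldShift (sitesPerDir_unit F K).symm V

/-- [folklore] `unitShift K (atTop K V) = V`. -/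
@[simp] theorem unitShift_atTop (K : ℕ) (V : UnitField F G) : unitShift K (atTop K V) = V :=
  fieldShift_symm_fieldShift (sitesPerDir_unit F K) V

/-- [folklore] `atTop K (unitShift K W) = W`. -/
@[simp] theorem atTop_unitShift (K : ℕ) (W : GaugeField (F.P K) K G) : atTop K (unitShift K W) = W :=
  fieldShift_fieldShift_symm (sitesPerDir_unit F K) W

/-- [folklore] `atTop 0` is the identity. -/
theorem atTop_zero (V : UnitField F G) : atTop 0 V = V := fieldShift_refl _ V

/-- [folklore] THE LADDER AT THE TOP: run B's copy of `V` (level `K + 1` of the `(K+1)`-st torus) read on run A's top level `K`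
IS run A's copy (`fieldShift` composes along equal moduli). -/
theorem ladderShift_atTop (K : ℕ) (V : UnitField F G) :
    ladderShift (F := F) (K := K) (K' := K + 1) rfl rfl (atTop (K + 1) V) = atTop K V :=
  fieldShift_fieldShift _ _ V

/-- [folklore] `atTop` is injective (it has the left inverse `unitShift`). -/
theorem atTop_injective (K : ℕ) : Function.Injective (atTop (F := F) (G := G) K) := fun V W h => by
  rw [← unitShift_atTop K V, ← unitShift_atTop K W, h]

end Unit

/-! ## §2 The two runs driven by the same `V` (DATA; the requirements DISPLAYED as fields, asserted for no particular datum) -/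

/-- [folklore] **THE TWO RUNS DRIVEN BY THE SAME UNIT-LATTICE FIELD** (T4-DAG §2 node U3; cell GAPS G-t4-U1a-2 ∕ G-t4-U3-5: the
pairing conventions are NOT printed and are recorded as data).  On top of the carriers of record `TwoRuns G`: both runs' complete
averaging families, level-homogeneous along the ladder and with run B's first averaging equal to the transport's; Bałaban's
background assignments of both runs ([Balaban1987RG1] (0.21) p. 256) as `Setup.Background` data; the common domain of driving
fields with the four membership requirements; the two coupling sequences.  No inequality inside. -/
structure DrivenRuns (G : Type) [GaugeGroup G] extends TwoRuns G where
  /-- run A's block averagings `T^{(j)}_ε → T^{(j+1)}_ε` of the `K`-th torus -/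
  avA : ∀ j, Averaging (F.P K) j G
  /-- run B's block averagings of the `(K+1)`-st torus -/
  avB : ∀ j, Averaging (F.P (K + 1)) j G
  /-- run B's first averaging is the one the transport `transportRaw F K av` uses -/
  avB_zero : avB 0 = av
  /-- LEVEL-HOMOGENEITY along the ladder: averaging run B's level `j + 1` and reading on run A's level `j + 1` = reading on run
  A's level `j` and averaging there (the same prescription at the same physical scale `L^{j+1}ε`) -/
  avA_ladder : ∀ (j : ℕ) (U : GaugeField (F.P (K + 1)) (j + 1) G),
    (avA j).avg (ladderShift (F := F) (K := K) (K' := K + 1) rfl rfl U) =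
      ladderShift (F := F) (K := K) (K' := K + 1) rfl rfl ((avB (j + 1)).avg U)
  /-- run A's background assignment `V ↦ U^A_k(V)` (minimisers on its domains, `Setup.IsBackground`) -/
  bgA : Background (F.P K) G avA
  /-- run B's background assignment `V ↦ U^B_k(V)` -/
  bgB : Background (F.P (K + 1)) G avB
  /-- the common domain of unit-lattice fields driving both runs -/
  domV : Set (UnitField F G)
  /-- every driving field, read on run A's top level, lies in the top domain of run A's assignment -/
  domV_A : ∀ V ∈ domV, atTop K V ∈ bgA.dom K
  /-- … and, read on run B's top level, in the top domain of run B's assignment -/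
  domV_B : ∀ V ∈ domV, atTop (K + 1) V ∈ bgB.dom (K + 1)
  /-- run A's background of a driving field is admissible -/
  memA : ∀ V ∈ domV, bgA.U K (atTop K V) ∈ admA
  /-- run B's background of a driving field is admissible -/
  memB : ∀ V ∈ domV, bgB.U (K + 1) (atTop (K + 1) V) ∈ admB
  /-- run A's coupling sequence `g^A_0, …, g^A_{K−1}` (node U2's; values beyond `K − 1` are not read by U3 at scales `≤ K`) -/
  gA : ℕ → ℝ
  /-- run B's coupling sequence `g^B_0, …, g^B_K` (one more coupling; `g^B_{j+1}` is paired with `g^A_j`) -/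
  gB : ℕ → ℝ

namespace DrivenRuns

variable {G : Type} [GaugeGroup G] (D : DrivenRuns G)

/-- [folklore] Run B's RE-INDEXED coupling sequence `j ↦ g^B_{j+1}` — the sequence node U3's functionals of run B are evaluated at
(`T4OutputRate` §1: run B's unpaired first coupling `g^B_0` is absorbed into `EB`). -/
def gBre : ℕ → ℝ := fun j => D.gB (j + 1)

/-- [folklore] `gBre j = gB (j + 1)`. -/
@[simp] theorem gBre_apply (j : ℕ) : D.gBre j = D.gB (j + 1) := rfl

/-! ## §3 The same-V background maps and their defining properties BY NAME -/

/-- [folklore] **`V ↦ U^A_K(V)`**: run A's background driven by `V ∈ domV`, as an admissible run-A background of the carriers of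
record ([Balaban1987RG1] (0.21) p. 256, the TYPE; the minimiser property is `isBackground_uA`). -/
def uA (V : D.domV) : D.carriers.BgA := ⟨D.bgA.U D.K (atTop D.K V.1), D.memA V.1 V.2⟩

/-- [folklore] **`V ↦ U^B_{K+1}(V)`**: run B's background driven by the SAME `V`, as an admissible run-B background. -/
def uB (V : D.domV) : D.carriers.BgB := ⟨D.bgB.U (D.K + 1) (atTop (D.K + 1) V.1), D.memB V.1 V.2⟩

/-- [folklore] The underlying configuration of `uA V`. -/
@[simp] theorem uA_val (V : D.domV) : (D.uA V).1 = D.bgA.U D.K (atTop D.K V.1) := rfl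

/-- [folklore] The underlying configuration of `uB V`. -/
@[simp] theorem uB_val (V : D.domV) : (D.uB V).1 = D.bgB.U (D.K + 1) (atTop (D.K + 1) V.1) := rfl

/-- [folklore] `U^A_K(V)` IS a background of run A over `V` in the sense of `Setup.IsBackground` (constraint ∧ regularity ∧
minimality) — the datum's field, by name. -/
theorem isBackground_uA (V : D.domV) : IsBackground D.avA D.bgA.reg D.K (atTop D.K V.1) (D.uA V).1 :=
  D.bgA.isBackground D.K _ (D.domV_A V.1 V.2)

/-- [folklore] `U^B_{K+1}(V)` IS a background of run B over the same `V`. -/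
theorem isBackground_uB (V : D.domV) :
    IsBackground D.avB D.bgB.reg (D.K + 1) (atTop (D.K + 1) V.1) (D.uB V).1 :=
  D.bgB.isBackground (D.K + 1) _ (D.domV_B V.1 V.2)

/-- [folklore] THE CONSTRAINT of run A: `M_A^K (U^A_K V) = V` (read on run A's top level). -/
theorem iter_uA (V : D.domV) : Averaging.iter D.avA D.K (D.uA V).1 = atTop D.K V.1 := (D.isBackground_uA V).1

/-- [folklore] THE CONSTRAINT of run B: `M_B^{K+1} (U^B_{K+1} V) = V` (read on run B's top level). -/
theorem iter_uB (V : D.domV) : Averaging.iter D.avB (D.K + 1) (D.uB V).1 = atTop (D.K + 1) V.1 :=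
  (D.isBackground_uB V).1

/-- [folklore] `U^A_K(V)` lies in run A's regularity class. -/
theorem uA_mem_reg (V : D.domV) : (D.uA V).1 ∈ D.bgA.reg := (D.isBackground_uA V).2.1

/-- [folklore] `U^B_{K+1}(V)` lies in run B's regularity class. -/
theorem uB_mem_reg (V : D.domV) : (D.uB V).1 ∈ D.bgB.reg := (D.isBackground_uB V).2.1

/-- [folklore] MINIMALITY of `U^A_K(V)` among regular run-A configurations with the same `K`-fold average. -/
theorem action_uA_le (V : D.domV) (U : GaugeField (D.F.P D.K) 0 G) (hreg : U ∈ D.bgA.reg)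
    (hc : Averaging.iter D.avA D.K U = atTop D.K V.1) : wilsonAction4 (D.uA V).1 ≤ wilsonAction4 U :=
  (D.isBackground_uA V).2.2 U hreg hc

/-- [folklore] MINIMALITY of `U^B_{K+1}(V)` among regular run-B configurations with the same `(K+1)`-fold average. -/
theorem action_uB_le (V : D.domV) (U : GaugeField (D.F.P (D.K + 1)) 0 G) (hreg : U ∈ D.bgB.reg)
    (hc : Averaging.iter D.avB (D.K + 1) U = atTop (D.K + 1) V.1) : wilsonAction4 (D.uB V).1 ≤ wilsonAction4 U :=
  (D.isBackground_uB V).2.2 U hreg hc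

/-! ## §4 The transport maps run B's constraint surface over `V` into run A's; the action comparison -/

/-- [folklore] The raw transport of the datum is «average once by `avB 0`, then read on run A's finest lattice». -/
theorem transportRaw_eq (U : GaugeField (D.F.P (D.K + 1)) 0 G) :
    transportRaw D.F D.K D.av U = ladderShift (F := D.F) (K := D.K) (K' := D.K + 1) rfl rfl ((D.avB 0).avg U) := by
  rw [← D.avB_zero]
  rfl

/-- [folklore] **ITERATED AVERAGES COMMUTE WITH THE TRANSPORT**: `M_A^k (transport U) = ladderShift (M_B^{k+1} U)` for every `k`
(induction on `k` with the level-homogeneity field `avA_ladder`). -/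
theorem iter_transportRaw (k : ℕ) (U : GaugeField (D.F.P (D.K + 1)) 0 G) :
    Averaging.iter D.avA k (transportRaw D.F D.K D.av U) =
      ladderShift (F := D.F) (K := D.K) (K' := D.K + 1) rfl rfl (Averaging.iter D.avB (k + 1) U) := by
  induction k with
  | zero => exact D.transportRaw_eq U
  | succ k ih =>
      show (D.avA k).avg (Averaging.iter D.avA k (transportRaw D.F D.K D.av U)) =
        ladderShift (F := D.F) (K := D.K) (K' := D.K + 1) rfl rfl ((D.avB (k + 1)).avg (Averaging.iter D.avB (k + 1) U))
      rw [ih, D.avA_ladder]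

/-- [folklore] **CONSTRAINT SURFACES CORRESPOND**: a run-B configuration with `(K+1)`-fold average `V` is transported to a run-A
configuration with `K`-fold average the SAME `V` ([Balaban1987RG1] (2.3) p. 265 is the printed instance of this kinematics). -/
theorem constraint_transport {U : GaugeField (D.F.P (D.K + 1)) 0 G} {V : UnitField D.F G}
    (hU : Averaging.iter D.avB (D.K + 1) U = atTop (D.K + 1) V) :
    Averaging.iter D.avA D.K (transportRaw D.F D.K D.av U) = atTop D.K V := by
  rw [iter_transportRaw, hU, ladderShift_atTop]

/-- [folklore] In particular `transport (U^B_{K+1} V)` lies on run A's constraint surface over `V`. -/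
theorem iter_transport_uB (V : D.domV) :
    Averaging.iter D.avA D.K (D.carriers.transport (D.uB V)).1 = atTop D.K V.1 :=
  D.constraint_transport (D.iter_uB V)

/-- [folklore] **THE ACTION COMPARISON AT THE SAME `V`** (first line of node U1b's minimal-action comparison; NO rate claimed):
if the transport maps run B's regularity class into run A's (displayed requirement), then
`A(U^A_K(V)) ≤ A(transport (U^B_{K+1}(V)))` — the transported finer minimiser is a competitor. -/
theorem action_uA_le_transport_uB (regMaps : Set.MapsTo (transportRaw D.F D.K D.av) D.bgB.reg D.bgA.reg) (V : D.domV) :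
    wilsonAction4 (D.uA V).1 ≤ wilsonAction4 (D.carriers.transport (D.uB V)).1 :=
  D.action_uA_le V _ (regMaps (D.uB_mem_reg V)) (D.iter_transport_uB V)

/-! ## §5 Node U3 ON THE OBJECT: NE3's consumer shape and the three brackets at the driven backgrounds -/

/-- [folklore] NE3's CONSUMER SHAPE on the driven runs, unfolded: the two runs' backgrounds driven by the same `V` are `δ`-close in
run A's gauge after transporting run B's (`T4OutputRate.BackgroundsClose`, by `Iff.rfl`). -/
theorem backgroundsClose_iff (δ : ℝ) :
    BackgroundsClose (C := D.carriers) D.uA D.uB δ ↔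
      ∀ V : D.domV, D.carriers.gauge (D.uA V) (D.carriers.transport (D.uB V)) ≤ δ :=
  Iff.rfl

/-- [folklore] **NODE U3's THREE BRACKETS AT THE SAME `V`** (T4-DAG §2 U3, `T4OutputRate.u3_threeBrackets` BY NAME at
`UA := U^A_K(V)`, `UB := U^B_{K+1}(V)`): NE9 ∧ Lipschitz-in-U ∧ NE5 on the carriers of record, and NE3's closeness of the driven
backgrounds, bound `|E^{(j),A}(X; g^A, U^A_K(V)) − E^{(j+1),B}(X; g^B_re, U^B_{K+1}(V))|` by
`(C_U(g^A, j)·δ + Σ_{i<j} Λ j i |g^A_i − g^B_{i+1}| + C₅θ^j)·e^{−κ d_j(X)}` — every located input visible, nothing else used. -/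
theorem u3_threeBrackets_driven {W : Set (ℕ → ℝ)} {EA : Functional D.carriers D.carriers.BgA}
    {EB : Functional D.carriers D.carriers.BgB} {κ θ C₅ : ℝ} {Λ : ℕ → ℕ → ℝ} {CU : (ℕ → ℝ) → ℕ → ℝ}
    (h9 : NE9 EA W κ Λ) (hU : LipBackground EA W κ CU) (h5 : NE5 EA EB W κ θ C₅)
    (hgA : D.gA ∈ W) (hgB : D.gBre ∈ W) {δ : ℝ} (hclose : BackgroundsClose (C := D.carriers) D.uA D.uB δ)
    (V : D.domV) (X : D.carriers.Dom) (hCU : 0 ≤ CU D.gA (D.carriers.scale X)) :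
    |EA D.gA (D.uA V) X - EB D.gBre (D.uB V) X| ≤
      (CU D.gA (D.carriers.scale X) * δ
        + (∑ i ∈ Finset.range (D.carriers.scale X), Λ (D.carriers.scale X) i * |D.gA i - D.gBre i|)
        + C₅ * θ ^ D.carriers.scale X) * Real.exp (-(κ * D.carriers.d X)) :=
  u3_threeBrackets h9 hU h5 hgA hgB (hclose V) X hCU

/-- [folklore] The carver's TARGET SHAPE at the same `V` (`T4OutputRate.u3_geometric` BY NAME): once the argument bracket and the
coupling bracket are `≤ a·θ^j`, `≤ b·θ^j`, the difference of the two runs' scale-`j` terms at the driven backgrounds is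
`≤ (a + b + C₅)·θ^j·e^{−κ d_j(X)}`. -/
theorem u3_geometric_driven {W : Set (ℕ → ℝ)} {EA : Functional D.carriers D.carriers.BgA}
    {EB : Functional D.carriers D.carriers.BgB} {κ θ C₅ : ℝ} {Λ : ℕ → ℕ → ℝ} {CU : (ℕ → ℝ) → ℕ → ℝ}
    (h9 : NE9 EA W κ Λ) (hU : LipBackground EA W κ CU) (h5 : NE5 EA EB W κ θ C₅)
    (hgA : D.gA ∈ W) (hgB : D.gBre ∈ W) {δ : ℝ} (hclose : BackgroundsClose (C := D.carriers) D.uA D.uB δ)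
    (V : D.domV) (X : D.carriers.Dom) (hCU : 0 ≤ CU D.gA (D.carriers.scale X)) {a b : ℝ}
    (ha : CU D.gA (D.carriers.scale X) * δ ≤ a * θ ^ D.carriers.scale X)
    (hb : (∑ i ∈ Finset.range (D.carriers.scale X), Λ (D.carriers.scale X) i * |D.gA i - D.gBre i|) ≤
      b * θ ^ D.carriers.scale X) :
    |EA D.gA (D.uA V) X - EB D.gBre (D.uB V) X| ≤
      (a + b + C₅) * θ ^ D.carriers.scale X * Real.exp (-(κ * D.carriers.d X)) :=
  u3_geometric h9 hU h5 hgA hgB (hclose V) X hCU ha hb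

end DrivenRuns

/-! ## §6 Non-vacuity: Bałaban's (0.4) averaging at every level of both runs; the trivially-driven instance -/

section Witness

variable {G : Type} [GaugeGroup G]

/-- [folklore] LEVEL-HOMOGENEITY IS A THEOREM FOR BAŁABAN's (0.4) AVERAGING: with `blockAvg ℰ` at every level of both runs the
field `avA_ladder` is `T4LevelShift.blockAvg_fieldShift` BY NAME. -/
theorem blockAvg_ladder (F : T4Family) (K : ℕ) (ℰ : LoopAverage G) (j : ℕ) (U : GaugeField (F.P (K + 1)) (j + 1) G) :
    (BlockAveraging.blockAvg (P := F.P K) (j := j) ℰ).avg (ladderShift (F := F) (K := K) (K' := K + 1) rfl rfl U) =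
      ladderShift (F := F) (K := K) (K' := K + 1) rfl rfl ((BlockAveraging.blockAvg (P := F.P (K + 1)) (j := j + 1) ℰ).avg U) :=
  blockAvg_fieldShift ℰ _ _ U

/-- [folklore] The background assignment with EMPTY domains (no field is claimed to have a minimiser; `U := 1` is never read). -/
def Background.empty (P : Params) (av : ∀ j, Averaging P j G) : Background P G av where
  reg := Set.univ
  dom := fun _ => ∅
  U := fun _ _ => 1
  isBackground := fun _ _ h => absurd h (Set.notMem_empty _)

/-- [folklore] **THE DRIVEN RUNS WITH BAŁABAN's BLOCK AVERAGING** ([Balaban1987RG1] (0.4) p. 253, the tree's `blockAvg ℰ`) at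
EVERY level of BOTH runs, unrestricted admissible classes, SUPPLIED background assignments `bgA ∕ bgB` and couplings; `domV` :=
the unit fields whose top copies lie in both assignments' top domains; the level-homogeneity DISCHARGED (`blockAvg_ladder`). -/
def DrivenRuns.balaban (F : T4Family) (K m' : ℕ) (ℰ : LoopAverage G)
    (bgA : Background (F.P K) G (fun j => BlockAveraging.blockAvg (j := j) ℰ))
    (bgB : Background (F.P (K + 1)) G (fun j => BlockAveraging.blockAvg (j := j) ℰ)) (gA gB : ℕ → ℝ) : DrivenRuns G where
  toTwoRuns := TwoRuns.univ F K m' (BlockAveraging.blockAvg ℰ)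
  avA := fun _ => BlockAveraging.blockAvg ℰ
  avB := fun _ => BlockAveraging.blockAvg ℰ
  avB_zero := rfl
  avA_ladder := blockAvg_ladder F K ℰ
  bgA := bgA
  bgB := bgB
  domV := {V | atTop K V ∈ bgA.dom K ∧ atTop (K + 1) V ∈ bgB.dom (K + 1)}
  domV_A := fun _ h => h.1
  domV_B := fun _ h => h.2
  memA := fun _ _ => Set.mem_univ _
  memB := fun _ _ => Set.mem_univ _
  gA := gA
  gB := gB

/-- [folklore] Its carriers are the unrestricted carriers of record with Bałaban's averaging as the transport. -/
theorem DrivenRuns.balaban_toTwoRuns (F : T4Family) (K m' : ℕ) (ℰ : LoopAverage G)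
    (bgA : Background (F.P K) G (fun j => BlockAveraging.blockAvg (j := j) ℰ))
    (bgB : Background (F.P (K + 1)) G (fun j => BlockAveraging.blockAvg (j := j) ℰ)) (gA gB : ℕ → ℝ) :
    (DrivenRuns.balaban F K m' ℰ bgA bgB gA gB).toTwoRuns = TwoRuns.univ F K m' (BlockAveraging.blockAvg ℰ) :=
  rfl

/-- [folklore] The structure is inhabited for every torus family, step number, cube exponent and small-loop average (empty
driving domain: nothing is claimed about any minimiser). -/
def DrivenRuns.trivial (F : T4Family) (K m' : ℕ) (ℰ : LoopAverage G) : DrivenRuns G :=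
  DrivenRuns.balaban F K m' ℰ (Background.empty _ _) (Background.empty _ _) (fun _ => 1) (fun _ => 1)

/-- [folklore] The trivially-driven instance has an empty driving domain (honest non-vacuity of the TYPING only). -/
theorem DrivenRuns.trivial_domV (F : T4Family) (K m' : ℕ) (ℰ : LoopAverage G) :
    (DrivenRuns.trivial (G := G) F K m' ℰ).domV = ∅ :=
  Set.eq_empty_iff_forall_notMem.mpr fun _ h => Set.notMem_empty _ h.1

end Witness

end Summit.QuantumFields.BalabanUV.T4Continuum.SubstrateTwoRunsDriven

end
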